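import Summits.QuantumFields.YangMills.Theorems.BalabanUVNodesN15TwoSpacingGluingCutEntries
import Summits.QuantumFields.YangMills.Theorems.BalabanUVNodesN15TwoSpacingGluingNeumannDefectClosed
import HarnessLib

/-!
# THE GLUING STEP AT TWO LATTICE SPACINGS, XLII: ENTRY 1 OF THE COVER's PARAMETRIX ON THE DOUBLED TORUS — `∇′_μ∘G₀′` DECAYS AND `𝔇(∇′_μG₀′, ∇_μG₀)` HAS THE RATE `(L^k)^{−1∕16}`,
# FROM dag-n15-a's CUT CUBE ROWS (dag-n15-c g13, FILE 84; N15 = NE2, s1 «background-layer OPERATOR ingredient»)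

Cell `pub-ymgap`, seat `pub-ymgap-dag-n15-c` (R134 (a); HUMAN RULING D-0062), generation 13.  `bears_on: R4∕N15 · K3⁷ SpineGivenEndpointR13SepCoPH (stmt-QuantumFields-20544)`.
Filed `--supports stmt-QuantumFields-20544 --as helper` — COUNT-NEUTRAL.  Theorems only (0 `def`, 0 `sorry`).  Imports BY NAME FILE 83 (the cut-row editions) and FILE 80 (through it
FILES 66–79 and dag-n15-a's PROGRAMME N); nothing in the tree is modified.

WHAT.  Doubled torus `M = MP (paramsOf d L (m+1) k hL)`, FILE 70's cover (cubes `□_k` of side `L·L^m`, Neumann propagators `knitG`, partition `knitH`), coarse `n = L^k`, fine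
`n′ = L^r·L^k`, King's pairing `P`, the parametrices `G₀ = Σ_k M_{h_k}G(□_k)M_{h_k}` at both spacings, the forward difference `∇_μ = fgrad n (bshiftEquiv μ)`:
* §1 partition side: ★ `coverH_shift_cut` (`M_{h_k∘e_μ}∘M_{χ_□} = M_{h_k∘e_μ}`), ★ `abs_coverH_shift_fine_sub_le` (two-grid fit of the SHIFTED partition function: `|h′_k(e′_μx′) −
  h_k(e_μ πx′)| ≤ π(d+1)∕(nw) + (π∕w)∕n′ + (π∕w)∕n`, from `h(ex) = h(x) + n⁻¹∇h(x)`), ★ `entryOneDefectConst_le` (compression of FILE 83's constant to `≤ D·(L^k)^{−1∕16}`);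
* §2 ★★★ **`hasMaj_grad_parametrix_knit`** — `∃ δ A > 0 ∀ m k r μ (k ≥ 1): ∇′_μ∘G₀′ ≤ A·e^{−δ|y−y′|_T}` (fine member, blocks through the pairing): FILE 83 `hasMaj_comp_parametrix_cut`
  with Leibniz `fgrad_comp_mulOp`, the cuts `coverH_shift_cut` ∕ FILE 65 `fgrad_hcube_cut`, the cut rows N-IIIb (`hasMaj_chiCube_symOp_comp` ∘ `hasMaj_comp_mulOp_chiInt`) and N
  `hasMaj_chiCube_grad_neumannCubeG_fine`, FILE 67's `|∇h| ≤ π∕w`, FILE 66's overlap `(2L)^{d+1}`;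
* (next file, FILE 85) §3 ★★★ `hasMaj_idef_grad_parametrix_knit` — the two-grid defect `𝔇(∇′_μG₀′, ∇_μG₀) ≤ D(L^k)^{−1∕16}e^{−δ|y−y′|_T}` (split for the 400-line limit).
FILES 84 + 85 are the entry-1 rows of FILE 50's `GluedLetters` for the glued `U ≡ 1` family of the cover (the `D′∘G₀′` majorant and the `𝔇(D′G₀′, DG₀)` defect).

HONEST FRAMING ∕ LIMITS.  Block-majorant bookkeeping over LANDED rows at `U ≡ 1` on the doubled-cube torus MODEL (cube = half torus; Neumann-by-images cubes); no new analytic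
estimate.  Nothing of [B5]∕[B6]∕[B9] asserted: [B6] (2.133)–(2.136) p.247 and [B9] Thm 3.14 pp.426–427 are SHAPES ∕ the difference TEMPLATE.  NE2⁺ NOT PRINTED, NOT proved; N15 NOT
discharged; counts of record UNMOVED (typed 28∕28 · discharged 5∕27); one finite 𝕋⁴ at fixed ε per index — NOT infinite volume, NOT OS on ℝ⁴, NOT a mass gap, NOT Clay; R4 closes
the conditional finite-𝕋⁴ rung `BalabanLadder.UV` only.  Restate-immune (no Theses import).
-/

noncomputable section

namespace Summit.QuantumFields.YangMills.BalabanUVNodes.N15.Gluing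

open Real
open Literature.MathematicalPhysics.QuantumFieldTheory.Balaban1983to89
open Literature.MathematicalPhysics.QuantumFieldTheory.Balaban1983to89.B5Prop11Plancherel (Tor fine)
open Literature.MathematicalPhysics.QuantumFieldTheory.Balaban1983to89.B11SectG (BlockNorm HasMaj RowSum)
open Literature.MathematicalPhysics.QuantumFieldTheory.Balaban1983to89.T4EtaRateDefect (idef)
open Literature.MathematicalPhysics.QuantumFieldTheory.Balaban1983to89.T4EtaRateCoeffDefect (pull)
open Literature.MathematicalPhysics.QuantumFieldTheory.Balaban1983to89.B6Prop26Gluing (mulOp mulOp_apply ind ind_nonneg ind_le_one)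
open Literature.MathematicalPhysics.QuantumFieldTheory.Balaban1983to89.B6UnitTorusCarrier (unitTorusGeo triangle254_unitTorusGeo rowSum_unitTorusGeo unitTorusGeo_dist_nonneg
  unitTorusGeo_dist_self)
open Literature.MathematicalPhysics.QuantumFieldTheory.Balaban1983to89.B5SiteBridgeP12 (MP)
open Literature.MathematicalPhysics.QuantumFieldTheory.King1986.Torus (blockOf tdistT tdistT_nonneg)
open Summit.QuantumFields.YangMills.BalabanUVNodes.N15.VectorPiece (bshiftEquiv kingPrV blkFine)
open Summit.QuantumFields.YangMills.BalabanUVNodes.N15.BackgroundLayer (fgrad fgrad_apply symbOp_sD_eq)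
open Summit.QuantumFields.YangMills.BalabanUVNodes.N15.TwoGrid (paramsOf deltaOp gOp neumannCubeG chiCube cubeBlocks ineq110_114_pair hasMaj_gOp_of_ineq hasMaj_chiCube_symOp_comp
  hasMaj_comp_mulOp_chiInt hasMaj_chiCube_grad_neumannCubeG hasMaj_chiCube_grad_neumannCubeG_fine hasMaj_idef_chiCube_neumannCubeG hasMaj_idef_chiCube_grad_neumannCubeG)

variable {d : ℕ}

/-! ## §1 The shifted partition function: cut, size, two-grid fit; the compression -/

section Partition

variable {M : Fin (d + 1) → ℕ} [∀ μ, NeZero (M μ)] {L kk r w q m₀ S : ℕ} [NeZero L] {n : ℕ} [NeZero n]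

/-- ★ `M_{h_k ∘ e_μ}∘M_{χ_□} = M_{h_k ∘ e_μ}`: the shifted partition function is supported where the cube's indicator is `1` (FILE 65's cut hypothesis at `x₀ = e_μ x`). [folklore] -/
theorem coverH_shift_cut (hM : ∀ ν, M ν = 2 * q * w) (hw : 0 < w) (hfit : m₀ + 2 * w + 1 ≤ S) (hS : S ≤ 2 * q * w) (μ : Fin (d + 1)) (k : Fin (d + 1) → ZMod (2 * q)) :
    mulOp (hcube (2 * q) (coverXi M n w) k ∘ ⇑(bshiftEquiv M n μ)) ∘ₗ mulOp (chiCube M n (coverCorner M w q m₀ k) S) =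
      mulOp (hcube (2 * q) (coverXi M n w) k ∘ ⇑(bshiftEquiv M n μ)) :=
  mulOp_comp_mulOp_of_support fun _ hx =>
    chi_eq_one_of_hcube_ne_zero (2 * q) (coverXi M n w) (bshiftEquiv M n) μ (chiCube_coverCorner_eq_one_side (M := M) (n := n) (m₀ := m₀) hM hw hfit hS μ k) (Or.inr (Or.inl rfl)) hx

omit [NeZero L] in
/-- ★ **THE TWO-GRID FIT OF THE SHIFTED PARTITION FUNCTION**: `|h′_k(e′_μ x′) − h_k(e_μ πx′)| ≤ π(d+1)∕(nw) + (π∕w)∕n′ + (π∕w)∕n` — from `h(e x) = h(x) + n⁻¹(∇h)(x)` at both spacings,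
FILE 67's fit `π(d+1)∕(nw)` and `|∇h| ≤ π∕w`. [cite: Balaban1984PropagatorsII, (2.36) p.229 (shape); Balaban1985BackgroundPropagators, Thm 3.14 pp.426–427 (difference template)] -/
theorem abs_coverH_shift_fine_sub_le [NeZero L] (hM : ∀ ν, M ν = 2 * q * w) (hw : 0 < w) (k : Fin (d + 1) → ZMod (2 * q)) (μ : Fin (d + 1))
    (x' : Tor (fine (L ^ r * L ^ kk) M) × Fin (d + 1)) :
    |hcube (2 * q) (coverXi M (L ^ r * L ^ kk) w) k (bshiftEquiv M (L ^ r * L ^ kk) μ x') - hcube (2 * q) (coverXi M (L ^ kk) w) k (bshiftEquiv M (L ^ kk) μ (kingPrV L kk r M x'))| ≤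
      π * (d + 1) / (((L ^ kk : ℕ) : ℝ) * w) + π / w / ((L ^ r * L ^ kk : ℕ) : ℝ) + π / w / ((L ^ kk : ℕ) : ℝ) := by
  have hL : 0 < L := Nat.pos_of_ne_zero (NeZero.ne L)
  have hn : (0 : ℝ) < ((L ^ kk : ℕ) : ℝ) := by positivity
  have hn' : (0 : ℝ) < ((L ^ r * L ^ kk : ℕ) : ℝ) := by positivity
  set h' := hcube (2 * q) (coverXi M (L ^ r * L ^ kk) w) k with hh'_def
  set h := hcube (2 * q) (coverXi M (L ^ kk) w) k with hh_def
  -- `h(e x) = h(x) + n⁻¹ ∇h(x)` at both spacings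
  have e1 : h' (bshiftEquiv M (L ^ r * L ^ kk) μ x') = h' x' + (((L ^ r * L ^ kk : ℕ) : ℝ))⁻¹ * fgrad ((L ^ r * L ^ kk : ℕ) : ℝ) (bshiftEquiv M (L ^ r * L ^ kk) μ) h' x' := by
    rw [fgrad_apply]; field_simp; ring
  have e2 : h (bshiftEquiv M (L ^ kk) μ (kingPrV L kk r M x')) =
      h (kingPrV L kk r M x') + (((L ^ kk : ℕ) : ℝ))⁻¹ * fgrad ((L ^ kk : ℕ) : ℝ) (bshiftEquiv M (L ^ kk) μ) h (kingPrV L kk r M x') := by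
    rw [fgrad_apply]; field_simp; ring
  have t0 := abs_coverH_fine_sub_le (L := L) (kk := kk) (r := r) hM hw k x'
  have t1 := abs_fgrad_coverH_le (n := L ^ r * L ^ kk) hM hw k μ x'
  have t2 := abs_fgrad_coverH_le (n := L ^ kk) hM hw k μ (kingPrV L kk r M x')
  rw [e1, e2]
  have hA : |(((L ^ r * L ^ kk : ℕ) : ℝ))⁻¹ * fgrad ((L ^ r * L ^ kk : ℕ) : ℝ) (bshiftEquiv M (L ^ r * L ^ kk) μ) h' x'| ≤ π / w / ((L ^ r * L ^ kk : ℕ) : ℝ) := by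
    rw [abs_mul, abs_inv, abs_of_pos hn', div_eq_mul_inv (π / w), mul_comm]
    exact mul_le_mul_of_nonneg_right t1 (inv_nonneg.mpr hn'.le)
  have hB : |(((L ^ kk : ℕ) : ℝ))⁻¹ * fgrad ((L ^ kk : ℕ) : ℝ) (bshiftEquiv M (L ^ kk) μ) h (kingPrV L kk r M x')| ≤ π / w / ((L ^ kk : ℕ) : ℝ) := by
    rw [abs_mul, abs_inv, abs_of_pos hn, div_eq_mul_inv (π / w), mul_comm]
    exact mul_le_mul_of_nonneg_right t2 (inv_nonneg.mpr hn.le)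
  calc |h' x' + (((L ^ r * L ^ kk : ℕ) : ℝ))⁻¹ * fgrad ((L ^ r * L ^ kk : ℕ) : ℝ) (bshiftEquiv M (L ^ r * L ^ kk) μ) h' x' -
          (h (kingPrV L kk r M x') + (((L ^ kk : ℕ) : ℝ))⁻¹ * fgrad ((L ^ kk : ℕ) : ℝ) (bshiftEquiv M (L ^ kk) μ) h (kingPrV L kk r M x'))|
      = |(h' x' - h (kingPrV L kk r M x')) + (((L ^ r * L ^ kk : ℕ) : ℝ))⁻¹ * fgrad ((L ^ r * L ^ kk : ℕ) : ℝ) (bshiftEquiv M (L ^ r * L ^ kk) μ) h' x' +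
          (-((((L ^ kk : ℕ) : ℝ))⁻¹ * fgrad ((L ^ kk : ℕ) : ℝ) (bshiftEquiv M (L ^ kk) μ) h (kingPrV L kk r M x')))| := by ring_nf
    _ ≤ |h' x' - h (kingPrV L kk r M x')| + |(((L ^ r * L ^ kk : ℕ) : ℝ))⁻¹ * fgrad ((L ^ r * L ^ kk : ℕ) : ℝ) (bshiftEquiv M (L ^ r * L ^ kk) μ) h' x'| +
          |(-((((L ^ kk : ℕ) : ℝ))⁻¹ * fgrad ((L ^ kk : ℕ) : ℝ) (bshiftEquiv M (L ^ kk) μ) h (kingPrV L kk r M x')))| := abs_add_three _ _ _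
    _ ≤ _ := by rw [abs_neg]; exact add_le_add (add_le_add t0 hA) hB

omit [∀ μ, NeZero (M μ)] [NeZero L] [NeZero n] in
/-- ★ the compression of FILE 83's entry-1 defect constant: every partition fit is `≤ K·ε` and every cut defect `∝ ε`, the derivative letter `c_d ≤ π`. [folklore] -/
theorem entryOneDefectConst_le {Nov β β₁ cd o os od mc me ε Ko Kos Kod : ℝ} (hNov : 0 ≤ Nov) (hβ : 0 ≤ β) (hβ₁ : 0 ≤ β₁) (hcdπ : cd ≤ π) (ho : 0 ≤ o)
    (hε : 0 ≤ ε) (hmc : 0 ≤ mc) (hoK : o ≤ Ko * ε) (hosK : os ≤ Kos * ε) (hodK : od ≤ Kod * ε) :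
    Nov * ((1 * β₁ * o + 1 * (me * ε) * 1 + os * β₁ * 1) + (cd * β * o + cd * (mc * ε) * 1 + od * β * 1)) ≤
      Nov * ((β₁ * Ko + me + Kos * β₁) + (π * β * Ko + π * mc + Kod * β)) * ε := by
  have hKo : 0 ≤ Ko * ε := ho.trans hoK
  have h1 : 1 * β₁ * o ≤ β₁ * Ko * ε := by nlinarith [mul_le_mul_of_nonneg_left hoK hβ₁]
  have h2 : os * β₁ * 1 ≤ Kos * β₁ * ε := by nlinarith [mul_le_mul_of_nonneg_left hosK hβ₁]
  have h3 : cd * β * o ≤ π * β * Ko * ε := by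
    have := mul_le_mul hcdπ (mul_le_mul_of_nonneg_left hoK hβ) (by positivity) (by positivity)
    nlinarith [this]
  have h4 : cd * (mc * ε) * 1 ≤ π * mc * ε := by nlinarith [mul_le_mul_of_nonneg_right hcdπ (by positivity : 0 ≤ mc * ε)]
  have h5 : od * β * 1 ≤ Kod * β * ε := by nlinarith [mul_le_mul_of_nonneg_left hodK hβ]
  have hsum : (1 * β₁ * o + 1 * (me * ε) * 1 + os * β₁ * 1) + (cd * β * o + cd * (mc * ε) * 1 + od * β * 1) ≤
      ((β₁ * Ko + me + Kos * β₁) + (π * β * Ko + π * mc + Kod * β)) * ε := by nlinarith [h1, h2, h3, h4, h5]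
  calc Nov * ((1 * β₁ * o + 1 * (me * ε) * 1 + os * β₁ * 1) + (cd * β * o + cd * (mc * ε) * 1 + od * β * 1))
      ≤ Nov * (((β₁ * Ko + me + Kos * β₁) + (π * β * Ko + π * mc + Kod * β)) * ε) := mul_le_mul_of_nonneg_left hsum hNov
    _ = _ := by ring

end Partition

/-! ## §2 `∇′_μ ∘ G₀′` decays -/

section OneGrid

variable {L : ℕ} [NeZero L]

/-- ★★★ **ENTRY 1 OF THE COVER's PARAMETRIX ON THE DOUBLED TORUS, FINE MEMBER**: for odd `L ≥ 3`, `a > 0` there are `δ, A > 0` (uniform in `m, k, r, μ`) with `∇′_μ∘G₀′ ≤ A·e^{−δ|y−y′|_T}`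
at the fine spacing `L^r·L^k` (blocks read through King's pairing), `k ≥ 1` — FILE 83 `hasMaj_comp_parametrix_cut` on dag-n15-a's cut rows. [cite: Balaban1984PropagatorsII, (2.133),
(2.136) p.247 (shapes + mechanism), (2.36)–(2.37) p.229; Balaban1984PropagatorsI, Prop. 1.2 (1.110) p.35] -/
theorem hasMaj_grad_parametrix_knit (hL : Odd L ∧ 1 < L) {a : ℝ} (ha : 0 < a) :
    ∃ δ A : ℝ, 0 < δ ∧ 0 < A ∧ ∀ (m kk r : ℕ) (_hk : 1 ≤ kk) (μ : Fin (d + 1)),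
      HasMaj (BlockNorm.ofBlocks (unitTorusGeo L kk (MP (paramsOf d L (m + 1) kk hL)))
          (fun i : Tor (fine (L ^ r * L ^ kk) (MP (paramsOf d L (m + 1) kk hL))) × Fin (d + 1) => blockOf (L ^ r * L ^ kk) (MP (paramsOf d L (m + 1) kk hL)) i.1))
        (BlockNorm.ofBlocks (unitTorusGeo L kk (MP (paramsOf d L (m + 1) kk hL)))
          (fun i : Tor (fine (L ^ r * L ^ kk) (MP (paramsOf d L (m + 1) kk hL))) × Fin (d + 1) => blockOf (L ^ r * L ^ kk) (MP (paramsOf d L (m + 1) kk hL)) i.1))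
        (fgrad ((L ^ r * L ^ kk : ℕ) : ℝ) (bshiftEquiv (MP (paramsOf d L (m + 1) kk hL)) (L ^ r * L ^ kk) μ) ∘ₗ
          parametrix (knitH d L m kk (L ^ r * L ^ kk) hL) (knitG d L m kk (L ^ r * L ^ kk) hL a))
        (fun y y' => A * Real.exp (-(δ * tdistT (MP (paramsOf d L (m + 1) kk hL)) y y'))) := by
  have hL3 : 3 ≤ L := by obtain ⟨⟨j, hj⟩, h1⟩ := hL; omega
  have hLpos : 0 < L := by omega
  obtain ⟨δ₀, C, Cα, Cε, Cαε, hδ₀, hC, H⟩ := ineq110_114_pair (d := d) hL ha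
  obtain ⟨δD, βD, hδD, hβD, HD⟩ := hasMaj_chiCube_grad_neumannCubeG_fine (d := d) hL ha
  set δ : ℝ := min δ₀ δD with hδ_def
  have hδ : 0 < δ := lt_min hδ₀ hδD
  set β : ℝ := 2 ^ (d + 1) * (C * Real.exp δ₀) with hβ_def
  have hβ : 0 ≤ β := by positivity
  set Nov : ℝ := (((2 * L) ^ (d + 1) : ℕ) : ℝ) with hNov_def
  refine ⟨δ, Nov * (1 * βD + π * β) + 1, hδ, by positivity, fun m kk r hk μ => ?_⟩
  set M : Fin (d + 1) → ℕ := MP (paramsOf d L (m + 1) kk hL) with hMdef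
  have hM : ∀ ν, M ν = 2 * L * L ^ m := MP_succ_eq L m kk hL
  have hM' : ∀ ν, M ν = 2 * (L * L ^ m) := fun ν => by rw [hM ν, mul_assoc]
  have hw : 0 < L ^ m := pow_pos hLpos m
  have hn' : 1 ≤ L ^ r * L ^ kk := Nat.one_le_iff_ne_zero.mpr (Nat.mul_ne_zero (pow_ne_zero r (NeZero.ne L)) (pow_ne_zero kk (NeZero.ne L)))
  have hfit := coverMargin_fit hL3 m
  have hfit1 : coverMargin L m + 2 * L ^ m + 1 ≤ L * L ^ m := by omega
  have hS : L * L ^ m ≤ 2 * L * L ^ m := by rw [mul_assoc]; omega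
  have hSe : L ^ (m + 1) = L * L ^ m := by rw [pow_succ, mul_comm]
  have hwR : (1 : ℝ) ≤ ((L ^ m : ℕ) : ℝ) := by exact_mod_cast hw
  have hind : ∀ (k : Fin (d + 1) → ZMod (2 * L)) (y y' : Tor M),
      0 ≤ ind (g := unitTorusGeo L kk M) ((cubeBlocks M (coverCorner M (L ^ m) L (coverMargin L m) k) (L * L ^ m) : Finset (Tor M)) : Set (Tor M)) y *
        ind (g := unitTorusGeo L kk M) ((cubeBlocks M (coverCorner M (L ^ m) L (coverMargin L m) k) (L * L ^ m) : Finset (Tor M)) : Set (Tor M)) y' :=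
    fun k y y' => mul_nonneg (ind_nonneg _ _) (ind_nonneg _ _)
  -- the cut rows at the fine spacing, rate weakened to `δ`
  have hG' := hasMaj_gOp_of_ineq (L := L) (k := kk) M (L ^ r * L ^ kk) a hn' (H (m + 1) kk r hk).2 hC.le
  have hGc' : ∀ k : Fin (d + 1) → ZMod (2 * L),
      HasMaj (BlockNorm.ofBlocks (unitTorusGeo L kk M) (fun i : Tor (fine (L ^ r * L ^ kk) M) × Fin (d + 1) => blockOf (L ^ r * L ^ kk) M i.1))
        (BlockNorm.ofBlocks (unitTorusGeo L kk M) (fun i : Tor (fine (L ^ r * L ^ kk) M) × Fin (d + 1) => blockOf (L ^ r * L ^ kk) M i.1))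
        (mulOp (chiCube M (L ^ r * L ^ kk) (coverCorner M (L ^ m) L (coverMargin L m) k) (L * L ^ m)) ∘ₗ knitG d L m kk (L ^ r * L ^ kk) hL a k)
        (fun y y' => ind ((cubeBlocks M (coverCorner M (L ^ m) L (coverMargin L m) k) (L * L ^ m) : Finset (Tor M)) : Set (Tor M)) y *
          ind ((cubeBlocks M (coverCorner M (L ^ m) L (coverMargin L m) k) (L * L ^ m) : Finset (Tor M)) : Set (Tor M)) y' * (β * Real.exp (-(δ * tdistT M y y')))) := fun k =>
    hasMaj_rate_le (hind k) hβ (min_le_left _ _)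
      (hasMaj_chiCube_symOp_comp (L := L) (k := kk) (c := coverCorner M (L ^ m) L (coverMargin L m) k) (S := L * L ^ m) hC.le hδ₀.le hM'
        (hasMaj_comp_mulOp_chiInt (c := coverCorner M (L ^ m) L (coverMargin L m) k) (S := L * L ^ m) hC.le hG'))
  have hDGc' : ∀ k : Fin (d + 1) → ZMod (2 * L),
      HasMaj (BlockNorm.ofBlocks (unitTorusGeo L kk M) (fun i : Tor (fine (L ^ r * L ^ kk) M) × Fin (d + 1) => blockOf (L ^ r * L ^ kk) M i.1))
        (BlockNorm.ofBlocks (unitTorusGeo L kk M) (fun i : Tor (fine (L ^ r * L ^ kk) M) × Fin (d + 1) => blockOf (L ^ r * L ^ kk) M i.1))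
        (mulOp (chiCube M (L ^ r * L ^ kk) (coverCorner M (L ^ m) L (coverMargin L m) k) (L * L ^ m)) ∘ₗ
          (fgrad ((L ^ r * L ^ kk : ℕ) : ℝ) (bshiftEquiv M (L ^ r * L ^ kk) μ) ∘ₗ knitG d L m kk (L ^ r * L ^ kk) hL a k))
        (fun y y' => ind ((cubeBlocks M (coverCorner M (L ^ m) L (coverMargin L m) k) (L * L ^ m) : Finset (Tor M)) : Set (Tor M)) y *
          ind ((cubeBlocks M (coverCorner M (L ^ m) L (coverMargin L m) k) (L * L ^ m) : Finset (Tor M)) : Set (Tor M)) y' * (βD * Real.exp (-(δ * tdistT M y y')))) :=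
    fun k => by
    have h := HD (m + 1) kk r hk (coverCorner M (L ^ m) L (coverMargin L m) k) μ
    rw [hSe, symbOp_sD_eq] at h
    exact hasMaj_rate_le (hind k) hβD.le (min_le_right _ _) h
  -- the partition: Leibniz, cuts, sizes, overlap
  have hχ' := fun ν k => chiCube_coverCorner_eq_one_side (M := M) (n := L ^ r * L ^ kk) (m₀ := coverMargin L m) hM hw hfit1 hS ν k
  have hleib : ∀ k : Fin (d + 1) → ZMod (2 * L), fgrad ((L ^ r * L ^ kk : ℕ) : ℝ) (bshiftEquiv M (L ^ r * L ^ kk) μ) ∘ₗ mulOp (knitH d L m kk (L ^ r * L ^ kk) hL k) =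
      mulOp (knitH d L m kk (L ^ r * L ^ kk) hL k ∘ ⇑(bshiftEquiv M (L ^ r * L ^ kk) μ)) ∘ₗ fgrad ((L ^ r * L ^ kk : ℕ) : ℝ) (bshiftEquiv M (L ^ r * L ^ kk) μ) +
        mulOp (fgrad ((L ^ r * L ^ kk : ℕ) : ℝ) (bshiftEquiv M (L ^ r * L ^ kk) μ) (knitH d L m kk (L ^ r * L ^ kk) hL k)) := fun k => fgrad_comp_mulOp _ _ _
  have hcuts := fun k : Fin (d + 1) → ZMod (2 * L) => coverH_shift_cut (n := L ^ r * L ^ kk) (m₀ := coverMargin L m) hM hw hfit1 hS μ k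
  have hcutd := fun k : Fin (d + 1) → ZMod (2 * L) => fgrad_hcube_cut (2 * L) (coverXi M (L ^ r * L ^ kk) (L ^ m)) (bshiftEquiv M (L ^ r * L ^ kk)) μ ((L ^ r * L ^ kk : ℕ) : ℝ) (hχ' μ k)
  have hh : ∀ (k : Fin (d + 1) → ZMod (2 * L)) x, |knitH d L m kk (L ^ r * L ^ kk) hL k x| ≤ 1 := fun k x => abs_coverH_le_one k x
  have hhs : ∀ (k : Fin (d + 1) → ZMod (2 * L)) x, |(knitH d L m kk (L ^ r * L ^ kk) hL k ∘ ⇑(bshiftEquiv M (L ^ r * L ^ kk) μ)) x| ≤ 1 := fun k x => abs_coverH_le_one k (bshiftEquiv M (L ^ r * L ^ kk) μ x)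
  have hdh : ∀ (k : Fin (d + 1) → ZMod (2 * L)) x, |fgrad ((L ^ r * L ^ kk : ℕ) : ℝ) (bshiftEquiv M (L ^ r * L ^ kk) μ) (knitH d L m kk (L ^ r * L ^ kk) hL k) x| ≤ π / ((L ^ m : ℕ) : ℝ) :=
    fun k x => abs_fgrad_coverH_le hM hw k μ x
  have hN := fun y => sum_ind_cubeBlocks_le (M := M) (w := L ^ m) (q := L) (m₀ := coverMargin L m) L kk y
  -- FILE 83
  have key := hasMaj_comp_parametrix_cut (g := unitTorusGeo L kk M) (fun i : Tor (fine (L ^ r * L ^ kk) M) × Fin (d + 1) => blockOf (L ^ r * L ^ kk) M i.1)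
    (fun k => ((cubeBlocks M (coverCorner M (L ^ m) L (coverMargin L m) k) (L * L ^ m) : Finset (Tor M)) : Set (Tor M))) hβ hβD.le zero_le_one
    (by positivity : (0 : ℝ) ≤ π / ((L ^ m : ℕ) : ℝ)) hleib hcuts hcutd hh hhs hdh hN hGc' hDGc'
  refine key.mono fun y y' => mul_le_mul_of_nonneg_right ?_ (Real.exp_nonneg _)
  have hπw : π / ((L ^ m : ℕ) : ℝ) * β ≤ π * β := mul_le_mul_of_nonneg_right (div_le_self Real.pi_pos.le hwR) hβ
  have h2 : Nov * (1 * βD + π / ((L ^ m : ℕ) : ℝ) * β) ≤ Nov * (1 * βD + π * β) := mul_le_mul_of_nonneg_left (by linarith) (by positivity)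
  linarith

end OneGrid

end Summit.QuantumFields.YangMills.BalabanUVNodes.N15.Gluing

end
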